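import Mathlib
import HarnessLib
import Summits.Ventures.LatticeQCDFlow.Exactness.SphereLuscherRecursionVariance
import Summits.Ventures.LatticeQCDFlow.Exactness.SphereSiteLaplacianCalculus

/-!
# First and second moments of the uniform product measure on the lattice of spheres, from Green's identity: `∫⟪w,x_n⟫ = 0`, `∫⟪a,x_n⟫⟪b,x_n⟫ = ⟪a,b⟫/d`, `∫⟪a,x_n⟫⟪b,x_m⟫ = 0`, `∫⟪x_n, U x_m⟫² = ‖U‖²_HS/d²`

HONEST FRAMING: exact (Metropolis-corrected) sampling algorithms for lattice gauge theory;
figures of merit are autocorrelation/cost numbers at stated couplings and volumes; no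
continuum-physics claim.

Venture `LatticeQCDFlow` (cell pub-lqcd), topic `Exactness`; FANOUT row 7 (`s0-cpn-null`).  NEW WORK
of the cell over the tree's `Exactness/SphereLatticeGreen.lean` (the lattice Green identity site by
site: `∫ G·∂̃_k·∂̃_k F dP = −∫⟪∂̃_kG, ∂̃_kF⟫ dP`), `Exactness/SphereSiteLaplacianCalculus.lean`
(`siteLaplacian_of_affine`: `∂̃_k·∂̃_k ⟪w, ·⟫ = −(d−1)⟪w, x_k⟫`; `siteLaplacian_of_quadratic`:
`∂̃_k·∂̃_k (⟪a,·⟫⟪b,·⟫) = 2⟪a,b⟫ − 2d⟪a,x_k⟫⟪b,x_k⟫` on the unit sphere) and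
`Exactness/SphereLuscherRecursionVariance.lean` (this leg: the rescaling `π̄ = σ(S)^{−|Λ|}·⊗σ`);
nothing is cited as a fact.  Printed counterpart, NAMED ONLY: the classical moments of the uniform
measure on `S^{d−1}` (`E[x] = 0`, `E[x xᵀ] = I/d`), here obtained WITHOUT rotation invariance or
polar coordinates: a function that is affine in one site variable is `−(d−1)⁻¹` times its own site
Laplacian, a rank-one quadratic one satisfies `d·F = ⟪a,b⟫ − ½∂̃²F`, and site Laplacians integrate
to zero.  These are the inputs of the sequel `Exactness/SphereActionVariance.lean` (the variance of
the Engel–Schaefer / CP(N−1) action under `π̄` — Lüscher's constant `ċ₁` — in closed form).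

## Setting

`E` finite-dimensional real inner product space, `d = dim E`; `Λ` finite; `π̄ = ⊗_Λ σ̄` the uniform
product probability measure on `Ω = S(E)^Λ` (`σ̄ = uniformSphere volume`); `b = stdOrthonormalBasis`;
for `U : E →L[ℝ] E`, `Σ_i ‖U† b_i‖²` is its squared Hilbert–Schmidt norm (`= Σ_i ‖U b_i‖²`,
`sum_norm_sq_adjoint_apply`).

## Content

* §1 TOOLS: **`integral_siteLaplacian_uniform_eq_zero`** (`∫ ∂̃_k·∂̃_k F dπ̄ = 0` for ONE site `k`,
  `F ∈ C²`); **`integral_eq_zero_of_site_affine`** (`d ≥ 2`: if `F(x[k ← y]) = ⟪w(x), y⟫` for all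
  `x, y` then `∫F dπ̄ = 0`); **`integral_site_quadratic`** (if `F(x[k ← y]) = ⟪a(x), y⟫⟪b(x), y⟫`
  then `d·∫F dπ̄ = ∫⟪a, b⟫ dπ̄`).
* §2 MOMENTS: **`integral_slin_uniform`** (`∫⟪w, x_n⟫dπ̄ = 0`), **`integral_slin_mul_slin_same`**
  (`∫⟪a, x_n⟫⟪b, x_n⟫dπ̄ = ⟪a, b⟫/d`), **`integral_slin_mul_slin_ne`** (`n ≠ m`:
  `∫⟪a, x_n⟫⟪b, x_m⟫dπ̄ = 0`), `sum_norm_sq_adjoint_apply`, **`integral_norm_sq_clm_apply`**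
  (`∫‖U x_m‖²dπ̄ = Σ_i‖U b_i‖²/d`), **`integral_sq_inner_clm_apply`** (`n ≠ m`:
  `∫⟪x_n, U x_m⟫²dπ̄ = Σ_i‖U b_i‖²/d²` — the second moment of one Engel–Schaefer link term).

NOT CLAIMED: higher moments; moments of the interacting measure `e^{−S}dπ`; anything about the rung.
-/

noncomputable section

namespace Summit.Ventures.LatticeQCDFlow.Exactness

open Function Set Metric MeasureTheory NormedSpace InnerProductSpace
open scoped RealInnerProductSpace

variable {Λ : Type*} {E : Type*} [NormedAddCommGroup E] [InnerProductSpace ℝ E]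
  [FiniteDimensional ℝ E] [MeasurableSpace E] [BorelSpace E]

/-! ## §1 Site Laplacians integrate to zero; affine and rank-one quadratic site dependence -/

section Tools

variable [Fintype Λ] [DecidableEq Λ] [Nontrivial E]

/-- **`∫ ∂̃_k·∂̃_k F dπ̄ = 0` for a single site `k`** (the site Green identity against the constant
`1`, rescaled to the probability measure). -/
theorem integral_siteLaplacian_uniform_eq_zero {F : (Λ → E) → ℝ} (hF : ContDiff ℝ 2 F) (k : Λ) :
    ∫ ω, siteLaplacian k F (fun n => ((ω : Λ → sphere (0 : E) 1) n : E))
        ∂Measure.pi (fun _ : Λ => uniformSphere (volume : Measure E)) = 0 := by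
  have h := integral_mul_siteLaplacian_eq_neg_integral_inner_siteGrad hF
    (G := fun _ : Λ → E => (1 : ℝ)) contDiff_const k
  have h0 : ∀ x : Λ → E, siteGrad k (fun _ : Λ → E => (1 : ℝ)) x = 0 := fun x => by
    rw [siteGrad, gradient, fderiv_const_apply, map_zero]
  simp only [one_mul, h0, inner_zero_left, integral_zero, neg_zero] at h
  rw [integral_pi_uniformSphere_eq_mul, h, mul_zero]

/-- **A functional that is affine in the site variable `x_k` has mean zero** (`d = dim E ≥ 2`): if
`F(x[k ← y]) = ⟪w(x), y⟫` for all `x`, `y`, then `∂̃_k·∂̃_k F = −(d−1) F` on `Ω`, so `∫F dπ̄ = 0`. -/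
theorem integral_eq_zero_of_site_affine (h2 : 2 ≤ Module.finrank ℝ E) {F : (Λ → E) → ℝ}
    (hF : ContDiff ℝ 2 F) (k : Λ) (w : (Λ → E) → E) (hw : ∀ x y, F (update x k y) = ⟪w x, y⟫) :
    ∫ ω, F (fun n => ((ω : Λ → sphere (0 : E) 1) n : E))
        ∂Measure.pi (fun _ : Λ => uniformSphere (volume : Measure E)) = 0 := by
  have hd : ((Module.finrank ℝ E : ℝ) - 1) ≠ 0 := by
    have : (2 : ℝ) ≤ Module.finrank ℝ E := by exact_mod_cast h2
    linarith
  have hlap : ∀ ω : Λ → sphere (0 : E) 1,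
      siteLaplacian k F (fun n => (ω n : E)) =
        -(((Module.finrank ℝ E : ℝ) - 1) * F (fun n => (ω n : E))) := fun ω => by
    have hx : ‖(fun n => ((ω n : sphere (0 : E) 1) : E)) k‖ = 1 := by simp
    have key := siteLaplacian_of_affine (G := F) (x := fun n => ((ω n : sphere (0 : E) 1) : E))
      (n := k) (w := w fun n => (ω n : E)) (c := 0) hx fun y => by rw [hw, add_zero]
    rw [key]
    have hF0 : F (fun n => ((ω n : sphere (0 : E) 1) : E)) =
        ⟪w (fun n => (ω n : E)), ((ω k : sphere (0 : E) 1) : E)⟫ := by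
      conv_lhs => rw [← update_eq_self k (fun n => ((ω n : sphere (0 : E) 1) : E)), hw]
    rw [hF0]
  have h0 := integral_siteLaplacian_uniform_eq_zero (Λ := Λ) hF k
  simp_rw [hlap, integral_neg, integral_const_mul, neg_eq_zero, mul_eq_zero] at h0
  exact h0.resolve_left hd

/-- **Rank-one quadratic site dependence**: if `F(x[k ← y]) = ⟪a(x), y⟫⟪b(x), y⟫` for all `x`, `y`
(with `a`, `b` continuous), then `∂̃_k·∂̃_k F = 2⟪a,b⟫ − 2d·F` on `Ω`, so `d·∫F dπ̄ = ∫⟪a, b⟫ dπ̄`. -/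
theorem integral_site_quadratic {F : (Λ → E) → ℝ} (hF : ContDiff ℝ 2 F) (k : Λ)
    (a b : (Λ → E) → E) (ha : Continuous a) (hb : Continuous b)
    (hab : ∀ x y, F (update x k y) = ⟪a x, y⟫ * ⟪b x, y⟫) :
    (Module.finrank ℝ E : ℝ) * ∫ ω, F (fun n => ((ω : Λ → sphere (0 : E) 1) n : E))
        ∂Measure.pi (fun _ : Λ => uniformSphere (volume : Measure E)) =
      ∫ ω, ⟪a (fun n => ((ω : Λ → sphere (0 : E) 1) n : E)), b (fun n => (ω n : E))⟫
        ∂Measure.pi (fun _ : Λ => uniformSphere (volume : Measure E)) := by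
  have hlap : ∀ ω : Λ → sphere (0 : E) 1,
      siteLaplacian k F (fun n => (ω n : E)) =
        2 * ⟪a (fun n => (ω n : E)), b (fun n => (ω n : E))⟫ -
          2 * (Module.finrank ℝ E : ℝ) * F (fun n => (ω n : E)) := fun ω => by
    have hx : ‖(fun n => ((ω n : sphere (0 : E) 1) : E)) k‖ = 1 := by simp
    have key := siteLaplacian_of_quadratic (G := F) (x := fun n => ((ω n : sphere (0 : E) 1) : E))
      (n := k) (a := a fun n => (ω n : E)) (b := b fun n => (ω n : E)) hx fun y => hab _ y
    rw [key]
    have hF0 : F (fun n => ((ω n : sphere (0 : E) 1) : E)) =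
        ⟪a (fun n => (ω n : E)), ((ω k : sphere (0 : E) 1) : E)⟫ *
          ⟪b (fun n => (ω n : E)), ((ω k : sphere (0 : E) 1) : E)⟫ := by
      conv_lhs => rw [← update_eq_self k (fun n => ((ω n : sphere (0 : E) 1) : E)), hab]
    rw [hF0]
  have h0 := integral_siteLaplacian_uniform_eq_zero (Λ := Λ) hF k
  simp_rw [hlap] at h0
  have hiab : Integrable (fun ω : Λ → sphere (0 : E) 1 =>
      2 * ⟪a (fun n => (ω n : E)), b (fun n => (ω n : E))⟫)
      (Measure.pi fun _ : Λ => uniformSphere (volume : Measure E)) :=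
    (integrable_pi_of_continuous _ ((ha.comp continuous_sphereConfig).inner
      (hb.comp continuous_sphereConfig))).const_mul _
  have hiF : Integrable (fun ω : Λ → sphere (0 : E) 1 =>
      2 * (Module.finrank ℝ E : ℝ) * F (fun n => (ω n : E)))
      (Measure.pi fun _ : Λ => uniformSphere (volume : Measure E)) :=
    (integrable_pi_of_continuous _ (hF.continuous.comp continuous_sphereConfig)).const_mul _
  rw [integral_sub hiab hiF, integral_const_mul, integral_const_mul] at h0
  linarith

end Tools

/-! ## §2 The moments -/

section Moments

variable [Fintype Λ] [DecidableEq Λ] [Nontrivial E]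

/-- **First moment: `∫ ⟪w, x_n⟫ dπ̄ = 0`** (`d ≥ 2`). -/
theorem integral_slin_uniform (h2 : 2 ≤ Module.finrank ℝ E) (w : E) (n : Λ) :
    ∫ ω, ⟪w, ((ω : Λ → sphere (0 : E) 1) n : E)⟫
        ∂Measure.pi (fun _ : Λ => uniformSphere (volume : Measure E)) = 0 := by
  have hF : ContDiff ℝ 2 (fun x : Λ → E => ⟪w, x n⟫) :=
    contDiff_const.inner ℝ (contDiff_apply ℝ E n)
  have h := integral_eq_zero_of_site_affine (Λ := Λ) h2 hF n (fun _ => w) fun x y => by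
    simp only [update_self]
  exact h

/-- **Second moment, one site: `∫ ⟪a, x_n⟫⟪b, x_n⟫ dπ̄ = ⟪a, b⟫/d`** (`E[x xᵀ] = I/d` on the
sphere, per site). -/
theorem integral_slin_mul_slin_same (a b : E) (n : Λ) :
    ∫ ω, ⟪a, ((ω : Λ → sphere (0 : E) 1) n : E)⟫ * ⟪b, ((ω : Λ → sphere (0 : E) 1) n : E)⟫
        ∂Measure.pi (fun _ : Λ => uniformSphere (volume : Measure E)) =
      ⟪a, b⟫ / (Module.finrank ℝ E : ℝ) := by
  have hd : (0 : ℝ) < (Module.finrank ℝ E : ℝ) := by exact_mod_cast Module.finrank_pos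
  have hF : ContDiff ℝ 2 (fun x : Λ → E => ⟪a, x n⟫ * ⟪b, x n⟫) :=
    (contDiff_const.inner ℝ (contDiff_apply ℝ E n)).mul (contDiff_const.inner ℝ (contDiff_apply ℝ E n))
  have h := integral_site_quadratic (Λ := Λ) hF n (fun _ => a) (fun _ => b) continuous_const
    continuous_const fun x y => by simp only [update_self]
  rw [integral_const, smul_eq_mul, Measure.real, measure_univ, ENNReal.toReal_one, one_mul] at h
  rw [eq_div_iff hd.ne', mul_comm]
  exact h

/-- **Second moment, two sites: `∫ ⟪a, x_n⟫⟪b, x_m⟫ dπ̄ = 0` for `n ≠ m`** (`d ≥ 2`; the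
integrand is linear in `x_n`). -/
theorem integral_slin_mul_slin_ne (h2 : 2 ≤ Module.finrank ℝ E) (a b : E) {n m : Λ} (hnm : n ≠ m) :
    ∫ ω, ⟪a, ((ω : Λ → sphere (0 : E) 1) n : E)⟫ * ⟪b, ((ω : Λ → sphere (0 : E) 1) m : E)⟫
        ∂Measure.pi (fun _ : Λ => uniformSphere (volume : Measure E)) = 0 := by
  have hF : ContDiff ℝ 2 (fun x : Λ → E => ⟪a, x n⟫ * ⟪b, x m⟫) :=
    (contDiff_const.inner ℝ (contDiff_apply ℝ E n)).mul (contDiff_const.inner ℝ (contDiff_apply ℝ E m))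
  exact integral_eq_zero_of_site_affine (Λ := Λ) h2 hF n (fun x => ⟪b, x m⟫ • a) fun x y => by
    simp only [update_self, update_of_ne hnm.symm, real_inner_smul_left]
    ring

omit [MeasurableSpace E] [BorelSpace E] [Fintype Λ] [DecidableEq Λ] [Nontrivial E] in
/-- The squared Hilbert–Schmidt norm in the standard basis is the same for `U` and `U†`:
`Σ_i ‖U† b_i‖² = Σ_i ‖U b_i‖²`. -/
theorem sum_norm_sq_adjoint_apply (U : E →L[ℝ] E) :
    ∑ i, ‖ContinuousLinearMap.adjoint U (stdOrthonormalBasis ℝ E i)‖ ^ 2 =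
      ∑ i, ‖U (stdOrthonormalBasis ℝ E i)‖ ^ 2 := by
  set B := stdOrthonormalBasis ℝ E
  have h1 : ∀ i, ‖ContinuousLinearMap.adjoint U (B i)‖ ^ 2 = ∑ j, ⟪B i, U (B j)⟫ ^ 2 := by
    intro i
    rw [← B.sum_sq_inner_right (ContinuousLinearMap.adjoint U (B i))]
    refine Finset.sum_congr rfl fun j _ => ?_
    rw [ContinuousLinearMap.adjoint_inner_right, real_inner_comm]
  have h2 : ∀ j, ‖U (B j)‖ ^ 2 = ∑ i, ⟪B i, U (B j)⟫ ^ 2 := fun j =>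
    (B.sum_sq_inner_right (U (B j))).symm
  simp_rw [h1, h2]
  exact Finset.sum_comm

/-- **`∫ ‖U x_m‖² dπ̄ = Σ_i ‖U b_i‖² / d`** (Parseval in the standard basis + the one-site second
moment). -/
theorem integral_norm_sq_clm_apply (U : E →L[ℝ] E) (m : Λ) :
    ∫ ω, ‖U (((ω : Λ → sphere (0 : E) 1) m : E))‖ ^ 2
        ∂Measure.pi (fun _ : Λ => uniformSphere (volume : Measure E)) =
      (∑ i, ‖U (stdOrthonormalBasis ℝ E i)‖ ^ 2) / (Module.finrank ℝ E : ℝ) := by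
  set B := stdOrthonormalBasis ℝ E
  have hpt : ∀ ω : Λ → sphere (0 : E) 1, ‖U ((ω m : E))‖ ^ 2 =
      ∑ i, ⟪ContinuousLinearMap.adjoint U (B i), (ω m : E)⟫ *
        ⟪ContinuousLinearMap.adjoint U (B i), (ω m : E)⟫ := fun ω => by
    rw [← B.sum_sq_inner_right (U (ω m : E))]
    refine Finset.sum_congr rfl fun i _ => ?_
    rw [ContinuousLinearMap.adjoint_inner_left, sq]
  simp_rw [hpt]
  have hc : Continuous fun ω : Λ → sphere (0 : E) 1 => ((ω m : sphere (0 : E) 1) : E) :=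
    continuous_subtype_val.comp (continuous_apply m)
  have hI : ∀ i, Integrable (fun ω : Λ → sphere (0 : E) 1 =>
      ⟪ContinuousLinearMap.adjoint U (B i), (ω m : E)⟫ *
        ⟪ContinuousLinearMap.adjoint U (B i), (ω m : E)⟫)
      (Measure.pi fun _ : Λ => uniformSphere (volume : Measure E)) := fun i =>
    integrable_pi_of_continuous _ ((continuous_const.inner hc).mul (continuous_const.inner hc))
  rw [integral_finsetSum Finset.univ fun i _ => hI i]
  simp_rw [integral_slin_mul_slin_same, real_inner_self_eq_norm_sq]
  rw [← Finset.sum_div, sum_norm_sq_adjoint_apply]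

/-- **The second moment of an Engel–Schaefer link term**: for `n ≠ m`,
`∫ ⟪x_n, U x_m⟫² dπ̄ = Σ_i ‖U b_i‖² / d²` (rank-one quadratic in `x_n` with `a = b = U x_m`, then the
previous lemma). -/
theorem integral_sq_inner_clm_apply (U : E →L[ℝ] E) {n m : Λ} (hnm : n ≠ m) :
    ∫ ω, ⟪((ω : Λ → sphere (0 : E) 1) n : E), U ((ω m : E))⟫ ^ 2
        ∂Measure.pi (fun _ : Λ => uniformSphere (volume : Measure E)) =
      (∑ i, ‖U (stdOrthonormalBasis ℝ E i)‖ ^ 2) / (Module.finrank ℝ E : ℝ) ^ 2 := by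
  have hd : (0 : ℝ) < (Module.finrank ℝ E : ℝ) := by exact_mod_cast Module.finrank_pos
  have hF : ContDiff ℝ 2 (fun x : Λ → E => ⟪x n, U (x m)⟫ ^ 2) :=
    ((contDiff_apply ℝ E n).inner ℝ (U.contDiff.comp (contDiff_apply ℝ E m))).pow 2
  have hU : Continuous fun x : Λ → E => U (x m) := U.continuous.comp (continuous_apply m)
  have h := integral_site_quadratic (Λ := Λ) hF n (fun x => U (x m)) (fun x => U (x m)) hU hU
    fun x y => by
      simp only [update_self, update_of_ne hnm.symm, real_inner_comm (U (x m))]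
      ring
  simp_rw [real_inner_self_eq_norm_sq] at h
  rw [integral_norm_sq_clm_apply, eq_div_iff hd.ne'] at h
  rw [eq_div_iff (pow_ne_zero 2 hd.ne')]
  have e : (∫ ω, ⟪((ω : Λ → sphere (0 : E) 1) n : E), U ((ω m : E))⟫ ^ 2
      ∂Measure.pi (fun _ : Λ => uniformSphere (volume : Measure E))) * (Module.finrank ℝ E : ℝ) ^ 2 =
      (Module.finrank ℝ E : ℝ) * (∫ ω, ⟪((ω : Λ → sphere (0 : E) 1) n : E), U ((ω m : E))⟫ ^ 2
        ∂Measure.pi (fun _ : Λ => uniformSphere (volume : Measure E))) * (Module.finrank ℝ E : ℝ) := by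
    ring
  rw [e]
  exact h

end Moments

end Summit.Ventures.LatticeQCDFlow.Exactness

end
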